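import Literature.Computability.Complexity.TruthTableClosure
import Literature.Computability.Complexity.Reductions
import HarnessLib

/-!
# Polynomial-time truth-table reducibility, `≤ᵖₜₜ`-hardness, and nonadaptive autoreducibility

Trunk `CplxCore`, vocabulary file continuing `TruthTableClosure.lean`. There a polynomial-time
**truth-table (nonadaptive) reduction** to a language `A` is given by three data — a query
generator `Q ∈ FP` (the `i`-th query on input `x` is `Q ⟨x, 1ⁱ⟩`), a query-count polynomial `q`
(the queries are those with `i < q(|x|)`) and an evaluator `D ∈ P` — and the reduced language is
`ttLang Q q D A = {x | ⟨x, [Q⟨x,1⁰⟩ ∈ A] ⋯ [Q⟨x,1^{q(|x|)-1}⟩ ∈ A]⟩ ∈ D}`. This file names the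
reducibility, hardness and self-reducibility notions built from it, in the form in which the
autoreducibility programme of Buhrman–Fortnow–van Melkebeek–Torenvliet (2000) uses them:

* `PolyTimeTTReducible K A` — `K ≤ᵖₜₜ A`: `K = ttLang Q q D A` for some `Q ∈ FP`, polynomial `q`,
  `D ∈ P` (Ladner–Lynch–Selman 1975, §3; Buhrman et al. 2000, §2: "the reduction `M` is
  *nonadaptive* if the oracle queries `M` makes on any input are independent of the oracle");
* `PolyTimeBddTTReducible k K A` — `K ≤ᵖ_{k-tt} A`: the same with the constant query count
  `q = C k` ("if the number of queries on an input of length `n` is bounded by `q(n)`, we write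
  `A ≤ᵖ_{q(n)-tt} B`", loc. cit.);
* `IsTTHard C A`, `IsBddTTHard k C A`, `IsTTComplete C A`, `IsBddTTComplete k C A` — `≤ᵖₜₜ`- and
  `≤ᵖ_{k-tt}`-hardness and -completeness for a class `C` ("a set is `≤ᵖᵣ`-hard for `𝒞` if we can
  `≤ᵖᵣ`-reduce every set in `𝒞` to it; if in addition it lies in `𝒞`, `≤ᵖᵣ`-complete", loc. cit.),
  companions of the Karp notions `IsHard`, `IsComplete` of `Reductions.lean`;
* **`IsTTAutoreducible A`** — `A` is *nonadaptively (truth-table) autoreducible*: there is a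
  polynomial-time truth-table reduction of `A` to itself that never queries its own input,
  i.e. `Q ⟨x, 1ⁱ⟩ ≠ x` for all `i < q(|x|)` and `A = ttLang Q q D A` (Buhrman et al. 2000,
  Definition 2.1, nonadaptive case; van Melkebeek 2000, §5.2).

API (all proved): unfolding lemmas; `≤ᵖ_{k-tt} ⇒ ≤ᵖₜₜ ⇒ ≤ᵖ_T` (`PolyTimeTTReducible.polyTimeTuringReducible`,
from `ttLang_mem_PRel`); `P` is closed downwards under `≤ᵖₜₜ` (`PolyTimeTTReducible.mem_P`);
Karp reductions are `1`-tt reductions (`PolyTimeKarpReducible.polyTimeBddTTReducible_one`), so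
`≤ᵖ_{1-tt}` and `≤ᵖₜₜ` are reflexive and Karp-hardness implies `1`-tt-hardness; hardness is
antitone in the class; every language in `P` is tt-autoreducible with no queries at all
(`isTTAutoreducible_of_mem_P`); an autoreduction is in particular a `≤ᵖₜₜ`-self-reduction.

With these names the crux `ThreeTTCompleteAutoreducible` of route `PneNP/Autoreducibility`
(Buhrman et al. 2000, Fig. 7, question 4, in `3`-query form) reads, definitionally,
`∀ A ∈ EXP, IsBddTTHard 3 EXP A → IsTTAutoreducible A` (`isBddTTHard_iff`, `isTTAutoreducible_iff`).

Not vendored here: transitivity of `≤ᵖₜₜ` and monotonicity of `≤ᵖ_{k-tt}` in `k` (both need a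
further transducer on the coded answer list), the adaptive (Turing) autoreducibility of
Definition 2.1 over `OracleAlg`, and its probabilistic / nonuniform variants.

## References

* H. Buhrman, L. Fortnow, D. van Melkebeek, L. Torenvliet, *Separating complexity classes using
  autoreducibility*, SIAM J. Comput. 29 (2000) 1497–1520, §2 (reductions `≤ᵖ_T`, `≤ᵖₜₜ`,
  `≤ᵖ_{q(n)-tt}`, `≤ᵖ_btt`, hardness, completeness; Definition 2.1: autoreducible), Fig. 7.
* D. van Melkebeek, *Randomness and Completeness in Computational Complexity*, LNCS 1950,
  Springer 2000, §2.4.2 (pp. 45–46: `≤ₜₜ`, `≤_{f(n)-tt}`, `≤_btt`), §5.2 (p. 118: autoreducible,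
  nonadaptive case).
* R. E. Ladner, N. A. Lynch, A. L. Selman, *A comparison of polynomial time reducibilities*,
  Theoret. Comput. Sci. 1 (1975) 103–123, §3 (`≤ᵖₜₜ` by a tt-condition generator and evaluator;
  `≤ᵖₘ ⇒ ≤ᵖₜₜ ⇒ ≤ᵖ_T`).
-/

namespace Literature.Computability.Complexity

open _root_.Computability Polynomial PRelSigma OracleCompose TTClosure
open scoped Notation

/-! ### Truth-table reducibility -/

/-- **`K ≤ᵖₜₜ A`, polynomial-time truth-table (nonadaptive) reducibility**: `K` is the language
truth-table reduced to `A` by some query generator `Q ∈ FP`, query-count polynomial `q` and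
evaluator `D ∈ P`, i.e. `K = ttLang Q q D A` — on input `x` the queries `Q ⟨x, 1ⁱ⟩`, `i < q(|x|)`,
are computed before any answer is received and `x` is accepted iff `⟨x, answer bits⟩ ∈ D`.
[Ladner–Lynch–Selman 1975, §3 (`≤ᵖₜₜ`); Buhrman–Fortnow–van Melkebeek–Torenvliet 2000, §2
("nonadaptive … we write `A ≤ᵖₜₜ B`")] [cite: BuhrmanEtAl2000, §2] -/
def PolyTimeTTReducible (K A : Language Bool) : Prop :=
  ∃ Q ∈ FP, ∃ q : Polynomial ℕ, ∃ D ∈ Classes.P, K = ttLang Q q D A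

/-- **`K ≤ᵖ_{k-tt} A`, polynomial-time `k`-query truth-table reducibility**: as `≤ᵖₜₜ` with the
constant query-count polynomial `C k`, i.e. `K = ttLang Q (C k) D A` for some `Q ∈ FP`, `D ∈ P`
(the queries on `x` are `Q ⟨x, 1⁰⟩, …, Q ⟨x, 1ᵏ⁻¹⟩`, repetitions allowed, so "at most `k`").
[Buhrman–Fortnow–van Melkebeek–Torenvliet 2000, §2 ("if the number of queries on an input of
length `n` is bounded by `q(n)`, we write `A ≤ᵖ_{q(n)-tt} B`"); van Melkebeek 2000, §2.4.2, p. 46]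
[cite: BuhrmanEtAl2000, §2] -/
def PolyTimeBddTTReducible (k : ℕ) (K A : Language Bool) : Prop :=
  ∃ Q ∈ FP, ∃ D ∈ Classes.P, K = ttLang Q (C k) D A

/-- Unfolding lemma for `≤ᵖₜₜ`. [Buhrman et al. 2000, §2] [cite: BuhrmanEtAl2000, §2] -/
theorem polyTimeTTReducible_iff {K A : Language Bool} :
    PolyTimeTTReducible K A ↔ ∃ Q ∈ FP, ∃ q : Polynomial ℕ, ∃ D ∈ Classes.P, K = ttLang Q q D A :=
  Iff.rfl

/-- Unfolding lemma for `≤ᵖ_{k-tt}`. [Buhrman et al. 2000, §2] [cite: BuhrmanEtAl2000, §2] -/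
theorem polyTimeBddTTReducible_iff {k : ℕ} {K A : Language Bool} :
    PolyTimeBddTTReducible k K A ↔ ∃ Q ∈ FP, ∃ D ∈ Classes.P, K = ttLang Q (C k) D A :=
  Iff.rfl

/-- **`≤ᵖ_{k-tt}` implies `≤ᵖₜₜ`** (take `q = C k`). [Buhrman et al. 2000, §2] [cite: BuhrmanEtAl2000, §2] -/
theorem PolyTimeBddTTReducible.polyTimeTTReducible {k : ℕ} {K A : Language Bool}
    (h : PolyTimeBddTTReducible k K A) : PolyTimeTTReducible K A := by
  obtain ⟨Q, hQ, D, hD, rfl⟩ := h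
  exact ⟨Q, hQ, C k, D, hD, rfl⟩

/-- **`≤ᵖₜₜ` implies `≤ᵖ_T`**: a truth-table reduction is a Turing reduction
(`ttLang Q q D A ∈ P^A`, `ttLang_mem_PRel`). [Ladner–Lynch–Selman 1975, §3 (`A ≤ᵖₜₜ B` implies
`A ≤ᵖ_T B`)] [cite: LadnerLynchSelman1975, §3] -/
theorem PolyTimeTTReducible.polyTimeTuringReducible {K A : Language Bool} (h : PolyTimeTTReducible K A) :
    PolyTimeTuringReducible K A := by
  obtain ⟨Q, hQ, q, D, hD, rfl⟩ := h
  exact ttLang_mem_PRel hQ hD A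

/-- **`P` is closed downwards under `≤ᵖₜₜ`**: `K ≤ᵖₜₜ A`, `A ∈ P` ⇒ `K ∈ P` (`ttLang_mem_P`,
i.e. `P^P = P`). [Ladner–Lynch–Selman 1975, §3; Arora–Barak 2009, §1.3] [cite: LadnerLynchSelman1975, §3] -/
theorem PolyTimeTTReducible.mem_P {K A : Language Bool} (h : PolyTimeTTReducible K A) (hA : A ∈ Classes.P) :
    K ∈ Classes.P := by
  obtain ⟨Q, hQ, q, D, hD, rfl⟩ := h
  exact ttLang_mem_P hQ hD hA

/-- `P` is closed downwards under `≤ᵖ_{k-tt}`. [Ladner–Lynch–Selman 1975, §3] [cite: LadnerLynchSelman1975, §3] -/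
theorem PolyTimeBddTTReducible.mem_P {k : ℕ} {K A : Language Bool} (h : PolyTimeBddTTReducible k K A)
    (hA : A ∈ Classes.P) : K ∈ Classes.P :=
  h.polyTimeTTReducible.mem_P hA

/-! ### Many-one reductions are one-query truth-table reductions -/

/-- The one-query evaluator "the (single) answer bit is `1`": `{w | 1 ∈ snd w}`. [folklore] -/
def oneQueryEval : Language Bool := sndP ⁻¹' HasBit true

/-- `oneQueryEval ∈ P`. [folklore] -/
theorem oneQueryEval_mem_P : oneQueryEval ∈ Classes.P :=
  preimage_mem_P (HasBit_mem_P true) sndP_mem_FP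

/-- **The one-query truth-table reduction asking `f x` and answering the answer**: with query
generator `f ∘ fst` (so `Q ⟨x, 1⁰⟩ = f x`) and evaluator `oneQueryEval`, the reduced language is
`f ⁻¹' A`. [Ladner–Lynch–Selman 1975, §3 (`≤ᵖₘ` implies `≤ᵖₜₜ`)] [cite: LadnerLynchSelman1975, §3] -/
theorem mem_ttLang_comp_fstP_one_iff (f : List Bool → List Bool) (A : Language Bool) (x : List Bool) :
    x ∈ ttLang (f ∘ fstP) (C 1) oneQueryEval A ↔ f x ∈ A := by
  -- the single answer bit is `[f x ∈ A]` (cf. `ToranCH.ttBits_one` in `CountingHierarchyOracle.lean`)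
  have h1 : ttBits (f ∘ fstP) A x 1 = [A.boolIndicator (f x)] := by simp [ttBits]
  rw [mem_ttLang_iff, eval_C, h1, oneQueryEval, memL_preimage, sndP_boolPair, mem_HasBit,
    List.mem_singleton, eq_comm, boolIndicator_eq_true_iff']

/-- **Karp reductions are `1`-tt reductions**: `K ≤ₚ A` implies `K ≤ᵖ_{1-tt} A` (ask the one query
`f x` and output its answer). [Ladner–Lynch–Selman 1975, §3 (`≤ᵖₘ ⇒ ≤ᵖₜₜ`); Buhrman et al. 2000, §2
("if the reduction asks only one query and answers the answer to that query, we write `≤ᵖₘ`")]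
[cite: BuhrmanEtAl2000, §2] -/
theorem PolyTimeKarpReducible.polyTimeBddTTReducible_one {K A : Language Bool} (h : K ≤ₚ A) :
    PolyTimeBddTTReducible 1 K A := by
  obtain ⟨f, hf, hfK⟩ := h
  refine ⟨f ∘ fstP, comp_mem_FP hf fstP_mem_FP, oneQueryEval, oneQueryEval_mem_P, ?_⟩
  ext x
  rw [mem_ttLang_comp_fstP_one_iff]
  exact hfK x

/-- Karp reductions are truth-table reductions: `K ≤ₚ A` implies `K ≤ᵖₜₜ A`.
[Ladner–Lynch–Selman 1975, §3] [cite: LadnerLynchSelman1975, §3] -/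
theorem PolyTimeKarpReducible.polyTimeTTReducible {K A : Language Bool} (h : K ≤ₚ A) :
    PolyTimeTTReducible K A :=
  h.polyTimeBddTTReducible_one.polyTimeTTReducible

/-- `≤ᵖ_{1-tt}` is reflexive (the identity Karp reduction). [Ladner–Lynch–Selman 1975, §3] [cite: LadnerLynchSelman1975, §3] -/
protected theorem PolyTimeBddTTReducible.refl_one (A : Language Bool) : PolyTimeBddTTReducible 1 A A :=
  (PolyTimeKarpReducible.refl A).polyTimeBddTTReducible_one

/-- `≤ᵖₜₜ` is reflexive. [Ladner–Lynch–Selman 1975, §3] [cite: LadnerLynchSelman1975, §3] -/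
protected theorem PolyTimeTTReducible.refl (A : Language Bool) : PolyTimeTTReducible A A :=
  (PolyTimeBddTTReducible.refl_one A).polyTimeTTReducible

/-! ### Hardness and completeness under truth-table reductions -/

/-- **`IsTTHard C A`: `A` is `≤ᵖₜₜ`-hard for the class `C`** — every `K ∈ C` satisfies `K ≤ᵖₜₜ A`.
[Buhrman et al. 2000, §2 ("a set `C` is `≤ᵖᵣ`-hard for `𝒞` if we can `≤ᵖᵣ`-reduce every set
`A ∈ 𝒞` to `C`")] [cite: BuhrmanEtAl2000, §2] -/
def IsTTHard (C : Set (Language Bool)) (A : Language Bool) : Prop :=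
  ∀ K ∈ C, PolyTimeTTReducible K A

/-- **`IsBddTTHard k C A`: `A` is `≤ᵖ_{k-tt}`-hard for `C`** — every `K ∈ C` satisfies `K ≤ᵖ_{k-tt} A`.
[Buhrman et al. 2000, §2] [cite: BuhrmanEtAl2000, §2] -/
def IsBddTTHard (k : ℕ) (C : Set (Language Bool)) (A : Language Bool) : Prop :=
  ∀ K ∈ C, PolyTimeBddTTReducible k K A

/-- **`IsTTComplete C A`: `A` is `≤ᵖₜₜ`-complete for `C`** — `A ∈ C` and `A` is `≤ᵖₜₜ`-hard for `C`.
[Buhrman et al. 2000, §2 ("if in addition `C ∈ 𝒞`, we call `C` `≤ᵖᵣ`-complete for `𝒞`")]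
[cite: BuhrmanEtAl2000, §2] -/
def IsTTComplete (C : Set (Language Bool)) (A : Language Bool) : Prop :=
  A ∈ C ∧ IsTTHard C A

/-- **`IsBddTTComplete k C A`: `A` is `≤ᵖ_{k-tt}`-complete for `C`.** [Buhrman et al. 2000, §2]
[cite: BuhrmanEtAl2000, §2] -/
def IsBddTTComplete (k : ℕ) (C : Set (Language Bool)) (A : Language Bool) : Prop :=
  A ∈ C ∧ IsBddTTHard k C A

/-- Unfolding lemma for `IsTTHard`. [Buhrman et al. 2000, §2] [cite: BuhrmanEtAl2000, §2] -/
theorem isTTHard_iff {C : Set (Language Bool)} {A : Language Bool} :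
    IsTTHard C A ↔ ∀ K ∈ C, ∃ Q ∈ FP, ∃ q : Polynomial ℕ, ∃ D ∈ Classes.P, K = ttLang Q q D A :=
  Iff.rfl

/-- Unfolding lemma for `IsBddTTHard` (the form in which route `PneNP/Autoreducibility` inlines
`≤ᵖ_{3-tt}`-hardness for `EXP`). [Buhrman et al. 2000, §2] [cite: BuhrmanEtAl2000, §2] -/
theorem isBddTTHard_iff {k : ℕ} {C : Set (Language Bool)} {A : Language Bool} :
    IsBddTTHard k C A ↔ ∀ K ∈ C, ∃ Q ∈ FP, ∃ D ∈ Classes.P, K = ttLang Q (Polynomial.C k) D A :=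
  Iff.rfl

/-- `≤ᵖ_{k-tt}`-hardness implies `≤ᵖₜₜ`-hardness. [Buhrman et al. 2000, §2] [cite: BuhrmanEtAl2000, §2] -/
theorem IsBddTTHard.isTTHard {k : ℕ} {C : Set (Language Bool)} {A : Language Bool} (h : IsBddTTHard k C A) :
    IsTTHard C A :=
  fun K hK => (h K hK).polyTimeTTReducible

/-- `≤ᵖ_{k-tt}`-completeness implies `≤ᵖₜₜ`-completeness. [Buhrman et al. 2000, §2] [cite: BuhrmanEtAl2000, §2] -/
theorem IsBddTTComplete.isTTComplete {k : ℕ} {C : Set (Language Bool)} {A : Language Bool}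
    (h : IsBddTTComplete k C A) : IsTTComplete C A :=
  ⟨h.1, h.2.isTTHard⟩

/-- A `≤ᵖₜₜ`-complete language is `≤ᵖₜₜ`-hard. [Buhrman et al. 2000, §2] [cite: BuhrmanEtAl2000, §2] -/
theorem IsTTComplete.isTTHard {C : Set (Language Bool)} {A : Language Bool} (h : IsTTComplete C A) :
    IsTTHard C A :=
  h.2

/-- A `≤ᵖₜₜ`-complete language belongs to its class. [Buhrman et al. 2000, §2] [cite: BuhrmanEtAl2000, §2] -/
theorem IsTTComplete.mem {C : Set (Language Bool)} {A : Language Bool} (h : IsTTComplete C A) : A ∈ C :=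
  h.1

/-- Karp-hardness (`IsHard`, `Reductions.lean`) implies `≤ᵖ_{1-tt}`-hardness. [Ladner–Lynch–Selman
1975, §3 (`≤ᵖₘ ⇒ ≤ᵖₜₜ`)] [cite: LadnerLynchSelman1975, §3] -/
theorem IsHard.isBddTTHard_one {C : Set (Language Bool)} {A : Language Bool} (h : IsHard C A) :
    IsBddTTHard 1 C A :=
  fun K hK => (h K hK).polyTimeBddTTReducible_one

/-- Karp-hardness implies `≤ᵖₜₜ`-hardness. [Ladner–Lynch–Selman 1975, §3] [cite: LadnerLynchSelman1975, §3] -/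
theorem IsHard.isTTHard {C : Set (Language Bool)} {A : Language Bool} (h : IsHard C A) : IsTTHard C A :=
  h.isBddTTHard_one.isTTHard

/-- Karp-completeness implies `≤ᵖₜₜ`-completeness. [Ladner–Lynch–Selman 1975, §3] [cite: LadnerLynchSelman1975, §3] -/
theorem IsComplete.isTTComplete {C : Set (Language Bool)} {A : Language Bool} (h : IsComplete C A) :
    IsTTComplete C A :=
  ⟨h.mem, h.isHard.isTTHard⟩

/-- Hardness is antitone in the class: hard for `C'` ⇒ hard for every `C ⊆ C'`. [folklore] -/
theorem IsTTHard.anti {C C' : Set (Language Bool)} {A : Language Bool} (hCC' : C ⊆ C') (h : IsTTHard C' A) :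
    IsTTHard C A :=
  fun K hK => h K (hCC' hK)

/-- Bounded hardness is antitone in the class. [folklore] -/
theorem IsBddTTHard.anti {k : ℕ} {C C' : Set (Language Bool)} {A : Language Bool} (hCC' : C ⊆ C')
    (h : IsBddTTHard k C' A) : IsBddTTHard k C A :=
  fun K hK => h K (hCC' hK)

/-- A `≤ᵖₜₜ`-hard language for `C` lying in `P` puts `C` inside `P`. [Ladner–Lynch–Selman 1975, §3;
Arora–Barak 2009, Thm. 2.8(2) (the Karp case)] [cite: LadnerLynchSelman1975, §3] -/
theorem IsTTHard.subset_P_of_mem_P {C : Set (Language Bool)} {A : Language Bool} (h : IsTTHard C A)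
    (hA : A ∈ Classes.P) : C ⊆ Classes.P :=
  fun K hK => (h K hK).mem_P hA

/-! ### Nonadaptive autoreducibility -/

/-- **`IsTTAutoreducible A`: `A` is nonadaptively (truth-table) autoreducible** — there is a
polynomial-time truth-table reduction of `A` to itself that never queries its own input: a query
generator `Q ∈ FP`, a query-count polynomial `q` and an evaluator `D ∈ P` with the
*self-avoidance* condition `Q ⟨x, 1ⁱ⟩ ≠ x` for all inputs `x` and all `i < q(|x|)`, and
`A = ttLang Q q D A`. [Buhrman–Fortnow–van Melkebeek–Torenvliet 2000, Definition 2.1 ("A set `A`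
is *autoreducible* if there is a reduction `M` of `A` to itself that never queries its own input,
i.e., for any input `x` and any oracle `B`, `x ∉ Q_{M^B}(x)`"; "for all these notions, we can
consider both the adaptive and the nonadaptive case" — for a nonadaptive `M` the query set
`Q_M(x)` does not depend on the oracle); van Melkebeek 2000, §5.2, p. 118]
[cite: BuhrmanEtAl2000, Definition 2.1] -/
def IsTTAutoreducible (A : Language Bool) : Prop :=
  ∃ Q ∈ FP, ∃ q : Polynomial ℕ, ∃ D ∈ Classes.P,
    (∀ x : List Bool, ∀ i < q.eval x.length, Q (boolPair x (List.replicate i true)) ≠ x) ∧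
      A = ttLang Q q D A

/-- Unfolding lemma for `IsTTAutoreducible` (the form in which route `PneNP/Autoreducibility`
inlines it). [Buhrman et al. 2000, Definition 2.1] [cite: BuhrmanEtAl2000, Definition 2.1] -/
theorem isTTAutoreducible_iff {A : Language Bool} :
    IsTTAutoreducible A ↔ ∃ Q ∈ FP, ∃ q : Polynomial ℕ, ∃ D ∈ Classes.P,
      (∀ x : List Bool, ∀ i < q.eval x.length, Q (boolPair x (List.replicate i true)) ≠ x) ∧
        A = ttLang Q q D A :=
  Iff.rfl

/-- An autoreduction is in particular a `≤ᵖₜₜ`-reduction of `A` to itself. [Buhrman et al. 2000,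
Definition 2.1] [cite: BuhrmanEtAl2000, Definition 2.1] -/
theorem IsTTAutoreducible.polyTimeTTReducible {A : Language Bool} (h : IsTTAutoreducible A) :
    PolyTimeTTReducible A A := by
  obtain ⟨Q, hQ, q, D, hD, -, hA⟩ := h
  exact ⟨Q, hQ, q, D, hD, hA⟩

/-- With no queries the reduced language is decided by the evaluator on `⟨x, ε⟩`: for the
evaluator `fst ⁻¹' A` it is `A` itself. [folklore] -/
theorem ttLang_zero_preimage_fstP (Q : List Bool → List Bool) (A : Language Bool) :
    ttLang Q 0 (fstP ⁻¹' A) A = A := by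
  ext x
  rw [mem_ttLang_iff, eval_zero, memL_preimage]
  simp [ttBits]

/-- **Every language in `P` is tt-autoreducible**, by the reduction that asks no queries at all
and decides `x ∈ A` directly (query count `q = 0`, evaluator `fst ⁻¹' A ∈ P`; self-avoidance is
vacuous; autoreducibility is a constraint only above `P`). [folklore] -/
theorem isTTAutoreducible_of_mem_P {A : Language Bool} (hA : A ∈ Classes.P) : IsTTAutoreducible A :=
  ⟨id, id_mem_FP, 0, fstP ⁻¹' A, preimage_mem_P hA fstP_mem_FP,
    fun x i hi => absurd hi (by simp), (ttLang_zero_preimage_fstP id A).symm⟩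

end Literature.Computability.Complexity
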